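import Literature.NumberTheory.EllipticCurves.BurungaleKobayashiOta2024.SupersingularPConverse
import Literature.NumberTheory.EllipticCurves.IsogenyMordellWeilRankProofs
import Literature.NumberTheory.EllipticCurves.ShaPrimaryIsogenyProofs
import HarnessLib

/-!
# BirchSwinnertonDyer — rank-2 `Ш[p^∞]` cell: the BLANKET ISOGENY COROLLARY of the census rows

HONEST FRAMING (cell `b2b-bsdr2sha`, run/shared/lean/b2b/bsd-rank2-sha/): per-pair certified
theorems «cited hypotheses ∧ certified computation ⇒ `Ш(E/ℚ)[p^∞]` finite of order `p^k`» for
rank-2 curves at good ordinary primes; NO claim on BSD in rank `≥ 2`, no class-level theorem, every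
published input is a NAMED HYPOTHESIS of the tree (nothing is asserted or minted here).

SCOPE READING (cell ruling (43)(c)): the census unit is `(isogeny class, p)` represented by the
`Γ₀(N)`-optimal curve (Cremona's curve no. 1); every booked reader (`ShaRow.booked_katoOne`, `…_katoLe`,
`…_su`, `…_rubinCM`, `…₃`, `…₄`, the w16 readers) concludes, for THAT curve `E` and its prime `p`,
`rank_ℤ E(ℚ) = 2 ∧ Ш(E/ℚ)[p^∞] finite ∧ …`. This file is the one blanket corollary that moves those two
conjuncts — and, along an isogeny of degree prime to `p`, the ORDER `#Ш(E/ℚ)[p^∞]` — to every curve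
`E'` that is `ℚ`-isogenous to `E`. The order of `Ш[p^∞]` is NOT an isogeny invariant in general (it
changes along a `p`-isogeny), hence the degree hypothesis in the second and third statements. Three
theorems, no definition, no named fact; everything used is a theorem of the tree:
`IsIsogenous.mordellWeilRank_eq` (Milne ADT I.7.3), `finite_primaryComponent_sha_iff_of_isIsogenous`
(Greenberg LNM 1716 §1 via the corank), `Isogeny.natCard_primaryComponent_sha_eq` (Milne ADT I.7.1(b)).

References: J. S. Milne, *Arithmetic Duality Theorems* (2006), I.7.1(b), I.7.3 [MilneADT2006];
R. Greenberg, LNM 1716 (1999), §1 [Greenberg1999LNM]; J. E. Cremona, *Algorithms for Modular Elliptic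
Curves* (1997), Table 1 (optimal curves) [CremonaAlgorithms1997].
-/

set_option autoImplicit false

-- single-conjunct summit: `Summit.BirchSwinnertonDyer.BirchSwinnertonDyer.…` repeats the name by design
set_option linter.dupNamespace false

noncomputable section

open scoped Classical

open WeierstrassCurve Literature.NumberTheory.EllipticCurves
  Literature.NumberTheory.EllipticCurves.BurungaleKobayashiOta2024

namespace Summit.BirchSwinnertonDyer.BirchSwinnertonDyer.Rank2Sha

/-- **Blanket isogeny corollary, finiteness form.** If a census reader gave `rank_ℤ E(ℚ) = 2` and
`Ш(E/ℚ)[p^∞]` finite for the class representative `E`, then every `ℚ`-isogenous `E'` has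
`rank_ℤ E'(ℚ) = 2` and `Ш(E'/ℚ)[p^∞]` finite (rank: Milne ADT I.7.3; finiteness of the `p`-primary part
through the `ℤ_p`-corank, Greenberg LNM 1716 §1). [cite: MilneADT2006, proof of Thm. I.7.3 (p. 97)]
[cite: Greenberg1999LNM, §1 pp. 54–57] -/
theorem rank_two_and_finite_sha_of_isIsogenous {E E' : WeierstrassCurve ℚ} [E.IsElliptic]
    [E'.IsElliptic] (hiso : IsIsogenous E E') (p : ℕ) [Fact p.Prime]
    (h : E.mordellWeilRank = 2 ∧ Finite (AddCommGroup.primaryComponent E.sha p)) :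
    E'.mordellWeilRank = 2 ∧ Finite (AddCommGroup.primaryComponent E'.sha p) :=
  ⟨hiso.mordellWeilRank_eq ▸ h.1, (finite_primaryComponent_sha_iff_of_isIsogenous hiso p).mp h.2⟩

/-- **Blanket isogeny corollary, order form (degree prime to `p`).** If a census reader gave
`rank_ℤ E(ℚ) = 2`, `Ш(E/ℚ)[p^∞]` finite and `#Ш(E/ℚ)[p^∞] = m` for the class representative `E`, and
`φ : E → E'` is a `ℚ`-isogeny of degree prime to `p`, then `rank_ℤ E'(ℚ) = 2`, `Ш(E'/ℚ)[p^∞]` is finite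
and `#Ш(E'/ℚ)[p^∞] = m` (Milne ADT I.7.1(b): `Ш(φ)` restricts to a bijection of the `p`-primary parts).
[cite: MilneADT2006, Ch. I Lemma 7.1(b) (proof), p. 96] [cite: MilneADT2006, proof of Thm. I.7.3 (p. 97)] -/
theorem rank_two_and_natCard_sha_of_isogeny {E E' : WeierstrassCurve ℚ} [E.IsElliptic]
    [E'.IsElliptic] (φ : Isogeny E E') (p : ℕ) [Fact p.Prime] (hdeg : ¬ p ∣ φ.degree) {m : ℕ}
    (h : E.mordellWeilRank = 2 ∧ Finite (AddCommGroup.primaryComponent E.sha p) ∧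
      Nat.card (AddCommGroup.primaryComponent E.sha p) = m) :
    E'.mordellWeilRank = 2 ∧ Finite (AddCommGroup.primaryComponent E'.sha p) ∧
      Nat.card (AddCommGroup.primaryComponent E'.sha p) = m := by
  have hiso : IsIsogenous E E' := ⟨φ⟩
  obtain ⟨hr, hfin⟩ := rank_two_and_finite_sha_of_isIsogenous hiso p ⟨h.1, h.2.1⟩
  exact ⟨hr, hfin, (φ.natCard_primaryComponent_sha_eq_iff p hdeg m).mp h.2.2⟩

/-- **Blanket isogeny corollary, valuation form (degree prime to `p`).** The V-BOUND `b` readers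
conclude `ord_p #Ш(E/ℚ)[p^∞] ≤ k`; along a `ℚ`-isogeny of degree prime to `p` the same bound holds for
`E'` (the two `p`-primary parts have the same cardinality). [cite: MilneADT2006, Ch. I Lemma 7.1(b) (proof), p. 96] -/
theorem rank_two_and_padicValNat_sha_le_of_isogeny {E E' : WeierstrassCurve ℚ} [E.IsElliptic]
    [E'.IsElliptic] (φ : Isogeny E E') (p : ℕ) [Fact p.Prime] (hdeg : ¬ p ∣ φ.degree) {k : ℤ}
    (h : E.mordellWeilRank = 2 ∧ Finite (AddCommGroup.primaryComponent E.sha p) ∧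
      (padicValNat p (Nat.card (AddCommGroup.primaryComponent E.sha p)) : ℤ) ≤ k) :
    E'.mordellWeilRank = 2 ∧ Finite (AddCommGroup.primaryComponent E'.sha p) ∧
      (padicValNat p (Nat.card (AddCommGroup.primaryComponent E'.sha p)) : ℤ) ≤ k := by
  have hiso : IsIsogenous E E' := ⟨φ⟩
  obtain ⟨hr, hfin⟩ := rank_two_and_finite_sha_of_isIsogenous hiso p ⟨h.1, h.2.1⟩
  refine ⟨hr, hfin, ?_⟩
  rw [← φ.natCard_primaryComponent_sha_eq p hdeg]
  exact h.2.2

end Summit.BirchSwinnertonDyer.BirchSwinnertonDyer.Rank2Sha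

end
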